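import Mathlib
import HarnessLib
import Literature.Computability.AlgebraicComplexity.PatternExpressions
import Literature.Computability.AlgebraicComplexity.ValiantClasses
import Literature.Computability.AlgebraicComplexity.ValiantClassesProofs
import Literature.Computability.AlgebraicComplexity.QPBoundedClosure
import Literature.Computability.AlgebraicComplexity.HomogeneousComponentsComplexity
import Literature.Computability.AlgebraicComplexity.ArithCircuit
import Summits.ValiantsHypothesis.ValiantsHypothesis.Theorems.MonotoneRestorationOrbitCompressionQPNarrowClosureSums
import Summits.ValiantsHypothesis.ValiantsHypothesis.Theorems.MonotoneRestorationMonotoneRestorationQPHomogeneousComponentVandermonde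
import Summits.ValiantsHypothesis.ValiantsHypothesis.Theorems.MonotoneRestorationOrbitCompressionQPHomogeneous

/-!
# Route MonotoneRestoration — aside `OrbitCompressionQP` (stmt-ValiantsHypothesis-18332), line
# `expression_compression`: the CONCLUSION class NQP of `stub_narrowExpressionCompression` is closed under
# homogeneous components (interpolation), consistently with the `VQP`-form characterisation

Helper file (`--supports stmt-ValiantsHypothesis-18332`), def-free.  Companion of
`Theorems/…OrbitCompressionQPHomogeneous.lean` (the stub reduces to homogeneous families) and of
`Theorems/…OrbitCompressionQPSymmetricSizeVQP.lean` (under the `VQP` form of the stub, NQP = matrix-symmetric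
∩ `VQP` ∩ narrow-of-some-length for p-families).  That characterisation predicts that NQP ∩ (p-bounded
degree) is closed under taking homogeneous components `f ↦ (f_n^{(d_n)})_n`, because the right-hand side
is.  This file PROVES the prediction unconditionally — a consistency check of the `VQP` form, and a tool:

* `exists_value_eq_aeval_scale` — SCALING a labelled pattern expression (`x ↦ t·x` on every edge: same
  labels, length `≤ 3·|e|`, value `= aeval (x ↦ t x) (value e)` at every assignment);
  `exists_close_eq_smul_aeval` — hence `w · f(t·x)` is a closed expression with the same labels and length
  `≤ 3|e| + 2` whenever `f = e.close n`;
* ★ `narrowQP_homogeneousComponent` — **NQP ∩ (p-bounded degree) is closed under homogeneous components**: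
  by Vandermonde interpolation at the nodes `0, 1, …, deg f_n + 1`
  (`Theorems.stub_homogeneousComponent_vandermonde`, in tree),
  `f_n^{(d)} = Σ_j (V⁻¹)_{d j} · f_n(j·x)` is a sum of `deg f_n + 2` scaled copies — same labels, length
  `× O(deg)` — re-assembled by `NarrowClosure.narrowQP_sum`; no depth reduction of expressions is needed
  (term-by-term homogenisation of a FORMULA would cost `deg^{depth}`);
* `isVQPFamily_homogeneousComponent` — `VQP` is closed under homogeneous components (BCS Lemma 21.25);
  `vqpNarrow_homogeneousComponent` — so is the right-hand side "matrix-symmetric ∩ `VQP` ∩ narrow of some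
  length" of the characterisation (`OrbitCompressionQPHomogeneous.homogeneousComponent_rename_perm`,
  `OrbitCompressionQPHomogeneous.exists_close_eq_homogeneousComponent`).

Honest label: closure bookkeeping for an open aside; no stub of the line is closed; `OrbitCompressionQP`, the
route and VP ≠ VNP are NOT moved.  References: Strassen 1973 / Bürgisser–Clausen–Shokrollahi 1997 Lemma
21.25 (homogeneous components by interpolation); Dawar–Pago–Seppelt 2025 §5.
-/

noncomputable section

-- `Summit.ValiantsHypothesis.ValiantsHypothesis.…` is the tree's single-conjunct layout (Sub = Summit).
set_option linter.dupNamespace false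

namespace Summit.ValiantsHypothesis.ValiantsHypothesis.Theorems.OrbitCompressionQPNarrowHomogeneous

open Literature.Computability.AlgebraicComplexity MvPolynomial
open Literature.Computability.AlgebraicComplexity.PatternExpr
open Summit.ValiantsHypothesis.ValiantsHypothesis.Theorems

/-! ### Scaling labelled pattern expressions -/

section Scaling

variable {k l : ℕ}

/-- **Scaling.**  Replacing every edge `x_{ρ a, γ b}` of an expression by `t · x_{ρ a, γ b}` gives an
expression with the same labels, length `≤ 3 |e|`, whose value at every assignment is the value of `e`
with the variables scaled by `t`. [folklore] -/
theorem exists_value_eq_aeval_scale (n : ℕ) (t : ℂ) (e : PatternExpr ℂ k l) :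
    ∃ e' : PatternExpr ℂ k l, e'.length ≤ 3 * e.length ∧
      ∀ (ρ : Fin k → Fin n) (γ : Fin l → Fin n), value n e' ρ γ =
        aeval (fun x : Fin n × Fin n => C t * X x) (value n e ρ γ) := by
  induction e with
  | edge a b =>
    exact ⟨mul (const t) (edge a b), by simp [PatternExpr.length], fun ρ γ => by simp⟩
  | const c =>
    exact ⟨const c, by simp [PatternExpr.length], fun ρ γ => by simp⟩
  | add e₁ e₂ ih₁ ih₂ =>
    obtain ⟨e₁', hl₁, h₁⟩ := ih₁
    obtain ⟨e₂', hl₂, h₂⟩ := ih₂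
    exact ⟨add e₁' e₂', by simp only [PatternExpr.length]; omega,
      fun ρ γ => by rw [value_add, h₁, h₂, value_add, map_add]⟩
  | mul e₁ e₂ ih₁ ih₂ =>
    obtain ⟨e₁', hl₁, h₁⟩ := ih₁
    obtain ⟨e₂', hl₂, h₂⟩ := ih₂
    exact ⟨mul e₁' e₂', by simp only [PatternExpr.length]; omega,
      fun ρ γ => by rw [value_mul, h₁, h₂, value_mul, map_mul]⟩
  | sumRow a e ih =>
    obtain ⟨e', hl, h⟩ := ih
    exact ⟨sumRow a e', by simp only [PatternExpr.length]; omega,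
      fun ρ γ => by simp only [value_sumRow, h, map_sum]⟩
  | sumCol b e ih =>
    obtain ⟨e', hl, h⟩ := ih
    exact ⟨sumCol b e', by simp only [PatternExpr.length]; omega,
      fun ρ γ => by simp only [value_sumCol, h, map_sum]⟩

/-- Hence `w · (e.close n)(t · x)` is a closed expression with the same labels and length `≤ 3|e| + 2`.
[folklore] -/
theorem exists_close_eq_smul_aeval {n : ℕ} (w t : ℂ) (e : PatternExpr ℂ k l) :
    ∃ e' : PatternExpr ℂ k l, e'.length ≤ 3 * e.length + 2 ∧
      e'.close n = w • aeval (fun x : Fin n × Fin n => C t * X x) (e.close n) := by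
  obtain ⟨e₁, hlen, hval⟩ := exists_value_eq_aeval_scale n t e
  refine ⟨mul (const w) e₁, by simp only [PatternExpr.length]; omega, ?_⟩
  unfold PatternExpr.close
  simp only [value_mul, value_const, hval, map_sum, Finset.smul_sum, smul_eq_C_mul]

end Scaling

/-! ### NQP is closed under homogeneous components -/

/-- Length bookkeeping: `3 · 2^((L+c)^c) + 2 ≤ 2^((L+c')^c')` for one `c'` depending on `c` only.
[folklore] -/
theorem three_mul_qp_add_two_le (c : ℕ) : ∃ c' : ℕ, c ≤ c' ∧ ∀ L X : ℕ,
    X ≤ 2 ^ ((L + c) ^ c) → 3 * X + 2 ≤ 2 ^ ((L + c') ^ c') := by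
  obtain ⟨c₁, hc₁⟩ := NarrowClosure.qp_combine c 0
  refine ⟨max c c₁, le_max_left _ _, fun L X hX => ?_⟩
  have h1 : (1 : ℕ) ≤ 2 ^ ((L + 0) ^ 0) := Nat.one_le_two_pow
  have h2 := hc₁ L X 1 hX h1
  calc 3 * X + 2 ≤ (X + 2) * (1 + 2) := by ring_nf; omega
    _ ≤ 2 ^ ((L + c₁) ^ c₁) := h2
    _ ≤ 2 ^ ((L + max c c₁) ^ max c c₁) :=
      Nat.pow_le_pow_right Nat.two_pos (IsQPBounded.qexp_mono L (le_max_right c c₁))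

/-- ★ **NQP ∩ (p-bounded degree) is closed under homogeneous components.**  If `f n` is, for every
`n ≥ 1`, the closed polynomial of a labelled pattern expression with `n^(k+l) ≤ 2^((log₂ n + c)^c)` and
length `≤ 2^((log₂ n + c)^c)`, and `deg f_n` is p-bounded, then the same holds for `(f_n^{(d_n)})_n`, for
every degree selector `d` (Vandermonde interpolation over `deg f_n + 2` scaled copies, re-assembled by
`NarrowClosure.narrowQP_sum`). [cite: DawarPagoSeppelt2025, §5] -/
theorem narrowQP_homogeneousComponent (f : (n : ℕ) → MvPolynomial (Fin n × Fin n) ℂ)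
    (hdeg : IsPBounded fun n => (f n).totalDegree)
    (hf : ∃ c : ℕ, ∀ n : ℕ, 1 ≤ n → ∃ (k l : ℕ) (e : PatternExpr ℂ k l),
      n ^ (k + l) ≤ 2 ^ ((Nat.log 2 n + c) ^ c) ∧ e.length ≤ 2 ^ ((Nat.log 2 n + c) ^ c) ∧
        e.close n = f n)
    (d : ℕ → ℕ) :
    ∃ c : ℕ, ∀ n : ℕ, 1 ≤ n → ∃ (k l : ℕ) (e : PatternExpr ℂ k l),
      n ^ (k + l) ≤ 2 ^ ((Nat.log 2 n + c) ^ c) ∧ e.length ≤ 2 ^ ((Nat.log 2 n + c) ^ c) ∧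
        e.close n = homogeneousComponent (d n) (f n) := by
  classical
  obtain ⟨c, hc⟩ := hf
  -- clipped selector: beyond the degree every component vanishes
  have hclip : ∀ n, homogeneousComponent (d n) (f n) =
      homogeneousComponent (min (d n) ((f n).totalDegree + 1)) (f n) := by
    intro n
    by_cases h : d n ≤ (f n).totalDegree + 1
    · rw [min_eq_left h]
    · rw [min_eq_right (by omega), homogeneousComponent_eq_zero _ _ (by omega),
        homogeneousComponent_eq_zero _ _ (by omega)]
  -- interpolation nodes `0, 1, …, deg f_n + 1`
  have ht : ∀ n : ℕ, Function.Injective (fun j : Fin ((f n).totalDegree + 1 + 1) => ((j : ℕ) : ℂ)) := by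
    intro n a b hab
    have hab' : ((a : ℕ) : ℂ) = ((b : ℕ) : ℂ) := hab
    exact Fin.ext (by exact_mod_cast hab')
  -- the summands
  let g : (n : ℕ) → ℕ → MvPolynomial (Fin n × Fin n) ℂ := fun n j =>
    if hj : j < (f n).totalDegree + 1 + 1 then
      (Matrix.vandermonde (fun j : Fin ((f n).totalDegree + 1 + 1) => ((j : ℕ) : ℂ)))⁻¹
          ⟨min (d n) ((f n).totalDegree + 1), by omega⟩ ⟨j, hj⟩ •
        aeval (fun x : Fin n × Fin n => C (((⟨j, hj⟩ : Fin ((f n).totalDegree + 1 + 1)) : ℕ) : ℂ) * X x)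
          (f n)
    else 0
  have hsum : ∀ n, ∑ j ∈ Finset.range ((f n).totalDegree + 1 + 1), g n j =
      homogeneousComponent (d n) (f n) := by
    intro n
    rw [hclip n, ← Theorems.stub_homogeneousComponent_vandermonde (f n)
      (by omega : (f n).totalDegree ≤ (f n).totalDegree + 1) _ (ht n)
      ⟨min (d n) ((f n).totalDegree + 1), by omega⟩, Finset.sum_range]
    refine Finset.sum_congr rfl fun j _ => ?_
    simp only [g, dif_pos j.isLt, Fin.eta]
  -- every summand is NQP, uniformly
  obtain ⟨c', hcc', hc'⟩ := three_mul_qp_add_two_le c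
  have hg : ∃ c₀ : ℕ, ∀ n : ℕ, 1 ≤ n → ∀ j : ℕ, j < (f n).totalDegree + 1 + 1 →
      ∃ (k l : ℕ) (e : PatternExpr ℂ k l),
        n ^ (k + l) ≤ 2 ^ ((Nat.log 2 n + c₀) ^ c₀) ∧ e.length ≤ 2 ^ ((Nat.log 2 n + c₀) ^ c₀) ∧
        e.close n = g n j := by
    refine ⟨c', fun n hn j hj => ?_⟩
    obtain ⟨k, l, e, hkl, hlen, he⟩ := hc n hn
    obtain ⟨e', hlen', he'⟩ := exists_close_eq_smul_aeval (n := n)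
      ((Matrix.vandermonde (fun j : Fin ((f n).totalDegree + 1 + 1) => ((j : ℕ) : ℂ)))⁻¹
          ⟨min (d n) ((f n).totalDegree + 1), by omega⟩ ⟨j, hj⟩)
      (((⟨j, hj⟩ : Fin ((f n).totalDegree + 1 + 1)) : ℕ) : ℂ) e
    refine ⟨k, l, e', hkl.trans (Nat.pow_le_pow_right Nat.two_pos (IsQPBounded.qexp_mono _ hcc')),
      hlen'.trans (hc' _ _ hlen), ?_⟩
    rw [he', he]
    simp only [g, dif_pos hj]
  have hm : ∃ c₀ : ℕ, ∀ n : ℕ, (f n).totalDegree + 1 + 1 ≤ 2 ^ ((Nat.log 2 n + c₀) ^ c₀) :=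
    (IsPBounded.add_holds (IsPBounded.add_holds hdeg (IsPBounded.const 1)) (IsPBounded.const 1)).isQPBounded
  obtain ⟨c₂, hc₂⟩ := NarrowClosure.narrowQP_sum (fun n => (f n).totalDegree + 1 + 1) g hm hg
  refine ⟨c₂, fun n hn => ?_⟩
  obtain ⟨k, l, e, h1, h2, h3⟩ := hc₂ n hn
  exact ⟨k, l, e, h1, h2, h3.trans (hsum n)⟩

/-! ### The right-hand side of the characterisation is closed under homogeneous components too -/

/-- **`VQP` is closed under homogeneous components** (for any degree selector; BCS Lemma 21.25 via
`complexity_homogeneousComponent_le_sq_mul`, and `f^{(d)} = 0` beyond the degree). [cite: Burgisser2000, Def. 2.26] -/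
theorem isVQPFamily_homogeneousComponent (f : (n : ℕ) → MvPolynomial (Fin n × Fin n) ℂ)
    (hf : IsVQPFamily f) (d : ℕ → ℕ) :
    IsVQPFamily fun n => homogeneousComponent (d n) (f n) := by
  obtain ⟨⟨hvars, hdeg⟩, hcomp⟩ := hf
  refine ⟨⟨hvars, hdeg.mono fun n => ?_⟩, ?_⟩
  · show (homogeneousComponent (d n) (f n)).totalDegree ≤ (f n).totalDegree
    by_cases h : (f n).totalDegree < d n
    · rw [homogeneousComponent_eq_zero _ _ h, totalDegree_zero]
      exact Nat.zero_le _
    · exact (homogeneousComponent_isHomogeneous (d n) (f n)).totalDegree_le.trans (not_lt.1 h)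
  · have hb : IsQPBounded fun n => ((f n).totalDegree + 2) ^ 2 * complexity (f n) :=
      IsQPBounded.mul
        ((IsPBounded.pow_holds (IsPBounded.add_holds hdeg (IsPBounded.const 2)) 2).isQPBounded) hcomp
    refine hb.mono fun n => ?_
    show complexity (homogeneousComponent (d n) (f n)) ≤ ((f n).totalDegree + 2) ^ 2 * complexity (f n)
    by_cases h : (f n).totalDegree < d n
    · rw [homogeneousComponent_eq_zero _ _ h, ← C_0, complexity_C_holds]
      exact Nat.zero_le _
    · calc complexity (homogeneousComponent (d n) (f n))
          ≤ (d n + 2) ^ 2 * complexity (f n) := complexity_homogeneousComponent_le_sq_mul (f n) (d n)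
        _ ≤ ((f n).totalDegree + 2) ^ 2 * complexity (f n) :=
          Nat.mul_le_mul_right _ (Nat.pow_le_pow_left (by omega) 2)

/-- **The class "matrix-symmetric ∩ `VQP` ∩ narrow of some length" is closed under homogeneous components**
(the right-hand side of `SymmetricSizeVQP.narrowQP_iff_of_vqpCompression`; consistent with
`narrowQP_homogeneousComponent` for the left-hand side). [cite: DawarPagoSeppelt2025, §5] -/
theorem vqpNarrow_homogeneousComponent (f : (n : ℕ) → MvPolynomial (Fin n × Fin n) ℂ)
    (hsymm : ∀ (n : ℕ) (σ τ : Equiv.Perm (Fin n)),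
      MvPolynomial.rename (fun p : Fin n × Fin n => (σ p.1, τ p.2)) (f n) = f n)
    (hVQP : IsVQPFamily f)
    (hnarrow : ∃ c : ℕ, ∀ n : ℕ, 1 ≤ n → ∃ (k l : ℕ) (e : PatternExpr ℂ k l),
      n ^ (k + l) ≤ 2 ^ ((Nat.log 2 n + c) ^ c) ∧ e.close n = f n)
    (d : ℕ → ℕ) :
    (∀ (n : ℕ) (σ τ : Equiv.Perm (Fin n)),
        MvPolynomial.rename (fun p : Fin n × Fin n => (σ p.1, τ p.2)) (homogeneousComponent (d n) (f n)) =
          homogeneousComponent (d n) (f n)) ∧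
      IsVQPFamily (fun n => homogeneousComponent (d n) (f n)) ∧
      ∃ c : ℕ, ∀ n : ℕ, 1 ≤ n → ∃ (k l : ℕ) (e : PatternExpr ℂ k l),
        n ^ (k + l) ≤ 2 ^ ((Nat.log 2 n + c) ^ c) ∧ e.close n = homogeneousComponent (d n) (f n) := by
  refine ⟨fun n σ τ => ?_, isVQPFamily_homogeneousComponent f hVQP d, ?_⟩
  · rw [← OrbitCompressionQPHomogeneous.homogeneousComponent_rename_perm, hsymm]
  · obtain ⟨c, hc⟩ := hnarrow
    refine ⟨c, fun n hn => ?_⟩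
    obtain ⟨k, l, e, hkl, he⟩ := hc n hn
    obtain ⟨e', he'⟩ := OrbitCompressionQPHomogeneous.exists_close_eq_homogeneousComponent (n := n) e (d n)
    exact ⟨k, l, e', hkl, by rw [he', he]⟩

end Summit.ValiantsHypothesis.ValiantsHypothesis.Theorems.OrbitCompressionQPNarrowHomogeneous

end
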